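import Summits.CriticalPhenomena.PercolationContinuityZ3.Theorems.PercNearOneGluingNoHeavyLowerTailFrontierDecRowsUnmarkedEdgeSymmetry
import HarnessLib

/-!
# The KEY form `K = 3B₁ − 2B₀` of an edge step: ONE five-point cubic inequality per (row, terminal) gives both
# unmarked-edge hypotheses — row 44 and PATH on every finite weighted graph from `K ≥ 0`

Support file (prover seat `prim-bnk-1`, gen 9; `--supports stmt-CriticalPhenomena-4575`).  No named facts, no sorries, no `native_decide`;
two bookkeeping definitions (`key`, the cubic form, and `KeyHypAt i₀`, the hypothesis package).  Sequel of
`…FrontierDecRowsUnmarkedEdgeSymmetry` (same namespace `TerminalEdgeInduction`).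

SETTING.  For three events `A, B, C`, a weight function `w` and an edge `e`, write `μ = μ⁰ = prodBernoulli w[e↦0]`, `ν = μ¹ = prodBernoulli w[e↦1]`
and `T(p)` for Sahi's `E₃(A,B,C)` when `e` carries the weight `p`.  `T` is a Bernstein cubic (tree: `EdgeInduction.sahiE3_oneBond`) with
coefficients `B₀ = E₃(μ)`, `B₁ = polar₁ μ ν A B C`, `B₂ = polar₁ ν μ A B C`, `B₃ = E₃(ν)`.  The unmarked-edge schema of gen 8
(`UnmarkedEdgeHypAt`, `frontier_44_all_of_at0`, `frontier_36_all_of_at0_at2`) asks for BOTH `B₁ ≥ 0` and `B₂ ≥ 0` (given the induction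
hypotheses `B₀, B₃ ≥ 0`) at every (terminal, unmarked) edge.  Following prim-facecert gen 4 (ttrl request l.904, `KEY pencil inequality`) put
  `K := 3·B₁ − 2·B₀ = T(0) + T'(0)`     (`key μ ν A B C`; the value at `p = 1` of the tangent of `T` at `p = 0`).
**Exact identities** (`polar₁_eq_key`, `three_mul_polar₁_swap`; pure algebra, `ring`):
  `B₁ = ⅔·B₀ + ⅓·K`,   `B₂ = ⅓·(B₀ + B₃) + ⅓·K + ⅓·π_A·π_B·π_C`,   `π_E := μ(E) − ν(E)`.
For DECREASING events `π_E ≥ 0` (`real_update_one_le_of_isLowerSet`: `ν(E) = μ{ω : insert e ω ∈ E} ≤ μ(E)`), so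
**`K ≥ 0` (given `B₀, B₃ ≥ 0`) implies `B₁ ≥ 0` and `B₂ ≥ 0`** (`unmarkedEdgeHypAt_of_keyHypAt`).  Consequences:
* **`frontier_44_all_of_key0`**: `(∀ m, KeyHypAt 0 …row 44…) → ∀ n w a b c y, 0 ≤ E₃(D[ab|cy], D[a|b], D[c|y])`;
* **`frontier_36_all_of_key0_key2`**: PATH `(D[a|b], D[a|c], D[b|y])` for all graphs from the KEY forms at the hub `a` and the leaf `c`;
* **`frontier_all_of_keyHyp (i : Fin 45)`**: every essential decreasing frontier row for all `n` from its KEY forms at all terminals.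
Also recorded: the KEY form under ONE law (`key_zero_one_connEvent`, a cubic in `μ⁰`-probabilities of the predicates, their conjunctions and
their lifts `liftPred t u` — for four terminals a cubic form in the 52-cell five-point law of `(a,b,c,y,u)` under `w[tu ↦ 0]`), and the pivotal
form (`key_eq_pivotal`): `K = E₃(μ) − 2·π_{ABC} + Σ_A π_A·Cov_μ(B,C) + Σ_A μ(A)·π_{BC}` (`π` = probability that `e` is pivotal).
So: ROW 44 FOR ALL GRAPHS ⟸ ONE cubic inequality `K ≥ 0` in the five-point law (edge `a — u`, `u` unmarked; IH rows `E₃ ≥ 0` under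
`w[au↦0]`, `w[au↦1]` admissible), PATH ⟸ two (edges `a — u`, `c — u`).  Census of `K ≥ 0` (facecert g4, exact rationals, n ≤ 8): 0 violations,
`K = 0` attained; `K ≥ B₃` and `K ≥ B₀` are FALSE (controls), so the slack `⅓(B₀+B₃)` in `B₂` is not what carries `B₁`.
-/

noncomputable section

namespace Summit.CriticalPhenomena.PercolationContinuityZ3.Theorems

namespace TerminalEdgeInduction

open MeasureTheory Literature.Probability.Percolation Literature.Probability.LatticeModels
open EdgeInduction CovTransferCert E3GroupSepCert
open scoped Classical

variable {n k : ℕ}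

/-! ### The KEY form and the two exact identities -/

/-- **The KEY form of an edge step**: `K = 3·F(μ,μ,ν) − 2·E₃(μ) = T(0) + T'(0)` for the Bernstein cubic `T` of `E₃(A,B,C)` along an edge
(`μ` = law with the edge closed, `ν` = law with the edge open). [this work] -/
def key (μ ν : Measure (BondConfig (Fin n))) (A B C : Set (BondConfig (Fin n))) : ℝ :=
  3 * polar₁ μ ν A B C - 2 * sahiE3 μ A B C

/-- `B₁ = ⅔·B₀ + ⅓·K`. [this work] -/
theorem polar₁_eq_key (μ ν : Measure (BondConfig (Fin n))) (A B C : Set (BondConfig (Fin n))) :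
    polar₁ μ ν A B C = (2 / 3 : ℝ) * sahiE3 μ A B C + (1 / 3 : ℝ) * key μ ν A B C := by
  simp only [key]
  ring

/-- `3·B₂ = B₀ + B₃ + K + π_A·π_B·π_C` with `π_E = μ(E) − ν(E)` — an identity of the cubic forms, valid for arbitrary reals. [this work] -/
theorem three_mul_polar₁_swap (μ ν : Measure (BondConfig (Fin n))) (A B C : Set (BondConfig (Fin n))) :
    3 * polar₁ ν μ A B C = sahiE3 μ A B C + sahiE3 ν A B C + key μ ν A B C
      + (μ.real A - ν.real A) * (μ.real B - ν.real B) * (μ.real C - ν.real C) := by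
  simp only [key, polar₁, sahiE3]
  ring

/-- The KEY form written out. [this work] -/
theorem key_eq (μ ν : Measure (BondConfig (Fin n))) (A B C : Set (BondConfig (Fin n))) :
    key μ ν A B C =
      2 * ν.real (A ∩ B ∩ C)
      + (ν.real A * μ.real B * μ.real C + μ.real A * ν.real B * μ.real C + μ.real A * μ.real B * ν.real C)
      - 2 * (μ.real A * μ.real B * μ.real C)
      + (μ.real A * μ.real (B ∩ C) + μ.real B * μ.real (A ∩ C) + μ.real C * μ.real (A ∩ B))
      - (ν.real A * μ.real (B ∩ C) + μ.real A * ν.real (B ∩ C) + ν.real B * μ.real (A ∩ C) + μ.real B * ν.real (A ∩ C)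
          + ν.real C * μ.real (A ∩ B) + μ.real C * ν.real (A ∩ B)) := by
  simp only [key, polar₁, sahiE3]
  ring

/-- **Pivotal form of KEY**: with `π_E = μ(E) − ν(E)`,
`K = E₃(μ) − 2·π_{ABC} + Σ_A π_A·(μ(B ∩ C) − μ(B)μ(C)) + Σ_A μ(A)·π_{B∩C}`. [this work] -/
theorem key_eq_pivotal (μ ν : Measure (BondConfig (Fin n))) (A B C : Set (BondConfig (Fin n))) :
    key μ ν A B C =
      sahiE3 μ A B C - 2 * (μ.real (A ∩ B ∩ C) - ν.real (A ∩ B ∩ C))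
      + ((μ.real A - ν.real A) * (μ.real (B ∩ C) - μ.real B * μ.real C)
          + (μ.real B - ν.real B) * (μ.real (A ∩ C) - μ.real A * μ.real C)
          + (μ.real C - ν.real C) * (μ.real (A ∩ B) - μ.real A * μ.real B))
      + (μ.real A * (μ.real (B ∩ C) - ν.real (B ∩ C)) + μ.real B * (μ.real (A ∩ C) - ν.real (A ∩ C))
          + μ.real C * (μ.real (A ∩ B) - ν.real (A ∩ B))) := by
  simp only [key, polar₁, sahiE3]
  ring

/-- `B₁ ≥ 0` from `B₀ ≥ 0` and `K ≥ 0`. [this work] -/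
theorem polar₁_nonneg_of_key {μ ν : Measure (BondConfig (Fin n))} {A B C : Set (BondConfig (Fin n))}
    (h0 : 0 ≤ sahiE3 μ A B C) (hK : 0 ≤ key μ ν A B C) : 0 ≤ polar₁ μ ν A B C := by
  rw [polar₁_eq_key]
  linarith

/-- `B₂ ≥ 0` from `B₀, B₃ ≥ 0`, `K ≥ 0` and `π_A·π_B·π_C ≥ 0`. [this work] -/
theorem polar₁_swap_nonneg_of_key {μ ν : Measure (BondConfig (Fin n))} {A B C : Set (BondConfig (Fin n))}
    (h0 : 0 ≤ sahiE3 μ A B C) (h1 : 0 ≤ sahiE3 ν A B C) (hK : 0 ≤ key μ ν A B C)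
    (hπ : 0 ≤ (μ.real A - ν.real A) * (μ.real B - ν.real B) * (μ.real C - ν.real C)) :
    0 ≤ polar₁ ν μ A B C := by
  have h := three_mul_polar₁_swap μ ν A B C
  linarith

/-! ### Monotonicity: opening an edge only loses a decreasing event -/

/-- **`μ_{w[e↦1]}(S) ≤ μ_{w[e↦0]}(S)` for a decreasing event `S`** (`μ_{w[e↦1]}` is the image of `μ_{w[e↦0]}` under `insert e`, and
`ω ⊆ insert e ω`). [folklore] -/
theorem real_update_one_le_of_isLowerSet (w : Sym2 (Fin n) → unitInterval) (e : Sym2 (Fin n)) {S : Set (BondConfig (Fin n))}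
    (hS : IsLowerSet S) :
    (prodBernoulli (Function.update w e 1)).real S ≤ (prodBernoulli (Function.update w e 0)).real S := by
  rw [real_update_one_eq_real_update_zero_insert]
  exact measureReal_mono (fun ω hω => hS (Set.subset_insert e ω) hω) (measure_ne_top _ _)

/-- The pivotal product `π_A·π_B·π_C ≥ 0` for three decreasing events. [this work] -/
theorem pivotal_prod_nonneg (w : Sym2 (Fin n) → unitInterval) (e : Sym2 (Fin n)) {A B C : Set (BondConfig (Fin n))}
    (hA : IsLowerSet A) (hB : IsLowerSet B) (hC : IsLowerSet C) :
    0 ≤ ((prodBernoulli (Function.update w e 0)).real A - (prodBernoulli (Function.update w e 1)).real A)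
        * ((prodBernoulli (Function.update w e 0)).real B - (prodBernoulli (Function.update w e 1)).real B)
        * ((prodBernoulli (Function.update w e 0)).real C - (prodBernoulli (Function.update w e 1)).real C) :=
  mul_nonneg (mul_nonneg (sub_nonneg.2 (real_update_one_le_of_isLowerSet w e hA))
    (sub_nonneg.2 (real_update_one_le_of_isLowerSet w e hB))) (sub_nonneg.2 (real_update_one_le_of_isLowerSet w e hC))

/-! ### The KEY hypotheses at one terminal, and the reduction of the unmarked-edge hypotheses to them -/

/-- **The KEY hypotheses at the terminal `i₀`**: for every `w`, injective marking `x`, unmarked `u` and `e = s(x i₀, u)`, the induction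
hypotheses `0 ≤ E₃` under `w[e↦0]` and `w[e↦1]` (same marking) imply `0 ≤ K = key μ_{w[e↦0]} μ_{w[e↦1]} (E₁ x) (E₂ x) (E₃ x)`. [this work] -/
def KeyHypAt (i₀ : Fin k) (E₁ E₂ E₃ : (Fin k → Fin n) → Set (BondConfig (Fin n))) : Prop :=
  ∀ (w : Sym2 (Fin n) → unitInterval) (x : Fin k → Fin n), Function.Injective x → ∀ (u : Fin n), (∀ j, x j ≠ u) →
    0 ≤ sahiE3 (prodBernoulli (Function.update w s(x i₀, u) 0)) (E₁ x) (E₂ x) (E₃ x) →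
    0 ≤ sahiE3 (prodBernoulli (Function.update w s(x i₀, u) 1)) (E₁ x) (E₂ x) (E₃ x) →
    0 ≤ key (prodBernoulli (Function.update w s(x i₀, u) 0)) (prodBernoulli (Function.update w s(x i₀, u) 1))
        (E₁ x) (E₂ x) (E₃ x)

variable {E₁ E₂ E₃ : (Fin k → Fin n) → Set (BondConfig (Fin n))}

/-- **KEY ⇒ both unmarked-edge hypotheses**, for families of decreasing events. [this work] -/
theorem unmarkedEdgeHypAt_of_keyHypAt {i₀ : Fin k} (hE₁ : ∀ x, IsLowerSet (E₁ x)) (hE₂ : ∀ x, IsLowerSet (E₂ x))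
    (hE₃ : ∀ x, IsLowerSet (E₃ x)) (h : KeyHypAt i₀ E₁ E₂ E₃) : UnmarkedEdgeHypAt i₀ E₁ E₂ E₃ := by
  intro w x hx u hu h0 h1
  have hK := h w x hx u hu h0 h1
  exact ⟨polar₁_nonneg_of_key h0 hK,
    polar₁_swap_nonneg_of_key h0 h1 hK (pivotal_prod_nonneg w s(x i₀, u) (hE₁ x) (hE₂ x) (hE₃ x))⟩

/-- The unmarked-edge hypotheses ARE of KEY type when `3·B₁ ≥ 2·B₀`; conversely KEY is implied by them together with `B₁ ≥ ⅔·B₀` — recorded as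
the trivial direction: `UnmarkedEdgeHypAt` gives `B₁ ≥ 0`, i.e. `K ≥ −2·B₀`. [this work] -/
theorem key_ge_of_unmarkedEdgeHypAt {i₀ : Fin k} (h : UnmarkedEdgeHypAt i₀ E₁ E₂ E₃) (w : Sym2 (Fin n) → unitInterval)
    (x : Fin k → Fin n) (hx : Function.Injective x) (u : Fin n) (hu : ∀ j, x j ≠ u)
    (h0 : 0 ≤ sahiE3 (prodBernoulli (Function.update w s(x i₀, u) 0)) (E₁ x) (E₂ x) (E₃ x))
    (h1 : 0 ≤ sahiE3 (prodBernoulli (Function.update w s(x i₀, u) 1)) (E₁ x) (E₂ x) (E₃ x)) :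
    -2 * sahiE3 (prodBernoulli (Function.update w s(x i₀, u) 0)) (E₁ x) (E₂ x) (E₃ x) ≤
      key (prodBernoulli (Function.update w s(x i₀, u) 0)) (prodBernoulli (Function.update w s(x i₀, u) 1))
        (E₁ x) (E₂ x) (E₃ x) := by
  have hB := (h w x hx u hu h0 h1).1
  simp only [key]
  linarith

/-! ### The KEY form under ONE law (connectivity events; lifts along the stepped edge) -/

/-- **KEY under one law**: `key μ⁰ μ¹` of three connectivity events as a cubic form in `μ⁰`-probabilities of the predicates, their
conjunctions (`pAnd`) and their lifts (`liftPred t u`). [this work] -/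
theorem key_zero_one_connEvent (w : Sym2 (Fin n) → unitInterval) (t u : Fin n) (P₁ P₂ P₃ : CRel n → Bool) :
    key (prodBernoulli (Function.update w s(t, u) 0)) (prodBernoulli (Function.update w s(t, u) 1))
        (connEvent P₁) (connEvent P₂) (connEvent P₃) =
      2 * (prodBernoulli (Function.update w s(t, u) 0)).real (connEvent (liftPred t u (pAnd (pAnd P₁ P₂) P₃)))
      + ((prodBernoulli (Function.update w s(t, u) 0)).real (connEvent (liftPred t u P₁))
            * (prodBernoulli (Function.update w s(t, u) 0)).real (connEvent P₂)
            * (prodBernoulli (Function.update w s(t, u) 0)).real (connEvent P₃)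
          + (prodBernoulli (Function.update w s(t, u) 0)).real (connEvent P₁)
            * (prodBernoulli (Function.update w s(t, u) 0)).real (connEvent (liftPred t u P₂))
            * (prodBernoulli (Function.update w s(t, u) 0)).real (connEvent P₃)
          + (prodBernoulli (Function.update w s(t, u) 0)).real (connEvent P₁)
            * (prodBernoulli (Function.update w s(t, u) 0)).real (connEvent P₂)
            * (prodBernoulli (Function.update w s(t, u) 0)).real (connEvent (liftPred t u P₃)))
      - 2 * ((prodBernoulli (Function.update w s(t, u) 0)).real (connEvent P₁)
            * (prodBernoulli (Function.update w s(t, u) 0)).real (connEvent P₂)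
            * (prodBernoulli (Function.update w s(t, u) 0)).real (connEvent P₃))
      + ((prodBernoulli (Function.update w s(t, u) 0)).real (connEvent P₁)
            * (prodBernoulli (Function.update w s(t, u) 0)).real (connEvent (pAnd P₂ P₃))
          + (prodBernoulli (Function.update w s(t, u) 0)).real (connEvent P₂)
            * (prodBernoulli (Function.update w s(t, u) 0)).real (connEvent (pAnd P₁ P₃))
          + (prodBernoulli (Function.update w s(t, u) 0)).real (connEvent P₃)
            * (prodBernoulli (Function.update w s(t, u) 0)).real (connEvent (pAnd P₁ P₂)))
      - ((prodBernoulli (Function.update w s(t, u) 0)).real (connEvent (liftPred t u P₁))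
            * (prodBernoulli (Function.update w s(t, u) 0)).real (connEvent (pAnd P₂ P₃))
          + (prodBernoulli (Function.update w s(t, u) 0)).real (connEvent P₁)
            * (prodBernoulli (Function.update w s(t, u) 0)).real (connEvent (liftPred t u (pAnd P₂ P₃)))
          + (prodBernoulli (Function.update w s(t, u) 0)).real (connEvent (liftPred t u P₂))
            * (prodBernoulli (Function.update w s(t, u) 0)).real (connEvent (pAnd P₁ P₃))
          + (prodBernoulli (Function.update w s(t, u) 0)).real (connEvent P₂)
            * (prodBernoulli (Function.update w s(t, u) 0)).real (connEvent (liftPred t u (pAnd P₁ P₃)))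
          + (prodBernoulli (Function.update w s(t, u) 0)).real (connEvent (liftPred t u P₃))
            * (prodBernoulli (Function.update w s(t, u) 0)).real (connEvent (pAnd P₁ P₂))
          + (prodBernoulli (Function.update w s(t, u) 0)).real (connEvent P₃)
            * (prodBernoulli (Function.update w s(t, u) 0)).real (connEvent (liftPred t u (pAnd P₁ P₂)))) := by
  rw [key_eq]
  simp only [← connEvent_pAnd, real_update_one_connEvent]

/-! ### The frontier rows: decreasing events; row 44, PATH and every row from the KEY forms -/

/-- The three events of every frontier row are decreasing. [this work] -/
theorem isLowerSet_row (i : Fin 45) (x : Fin 4 → Fin n) :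
    IsLowerSet (connEvent (FrontierDecRows.row i n (x 0, x 1, x 2, x 3)).1) ∧
      IsLowerSet (connEvent (FrontierDecRows.row i n (x 0, x 1, x 2, x 3)).2.1) ∧
      IsLowerSet (connEvent (FrontierDecRows.row i n (x 0, x 1, x 2, x 3)).2.2) := by
  fin_cases i <;> exact ⟨isLowerSet_connEvent_sep _ _, isLowerSet_connEvent_sep _ _, isLowerSet_connEvent_sep _ _⟩

/-- KEY ⇒ unmarked-edge hypotheses, for a frontier row at one terminal. [this work] -/
theorem unmarkedEdgeHypAt_row_of_keyHypAt (i : Fin 45) {m : ℕ} (i₀ : Fin 4)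
    (h : KeyHypAt i₀ (fun x : Fin 4 → Fin m => connEvent (FrontierDecRows.row i m (x 0, x 1, x 2, x 3)).1)
      (fun x => connEvent (FrontierDecRows.row i m (x 0, x 1, x 2, x 3)).2.1)
      (fun x => connEvent (FrontierDecRows.row i m (x 0, x 1, x 2, x 3)).2.2)) :
    UnmarkedEdgeHypAt i₀ (fun x : Fin 4 → Fin m => connEvent (FrontierDecRows.row i m (x 0, x 1, x 2, x 3)).1)
      (fun x => connEvent (FrontierDecRows.row i m (x 0, x 1, x 2, x 3)).2.1)
      (fun x => connEvent (FrontierDecRows.row i m (x 0, x 1, x 2, x 3)).2.2) :=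
  unmarkedEdgeHypAt_of_keyHypAt (fun x => (isLowerSet_row i x).1) (fun x => (isLowerSet_row i x).2.1)
    (fun x => (isLowerSet_row i x).2.2) h

/-- **Row 44 on every finite weighted graph from ONE family of KEY forms**: `K ≥ 0` at the edges `a — u` (`u` unmarked; given the IH rows)
for every number of vertices implies `0 ≤ E₃(D[ab|cy], D[a|b], D[c|y])` for all `n`, `w` and all `a b c y`. [this work] -/
theorem frontier_44_all_of_key0
    (h : ∀ m : ℕ, KeyHypAt 0 (fun x : Fin 4 → Fin m => connEvent (FrontierDecRows.row 44 m (x 0, x 1, x 2, x 3)).1)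
      (fun x => connEvent (FrontierDecRows.row 44 m (x 0, x 1, x 2, x 3)).2.1)
      (fun x => connEvent (FrontierDecRows.row 44 m (x 0, x 1, x 2, x 3)).2.2))
    (w : Sym2 (Fin n) → unitInterval) (a b c y : Fin n) :
    0 ≤ sahiE3 (prodBernoulli w) (connEvent (FrontierDecRows.row 44 n (a, b, c, y)).1)
      (connEvent (FrontierDecRows.row 44 n (a, b, c, y)).2.1) (connEvent (FrontierDecRows.row 44 n (a, b, c, y)).2.2) :=
  frontier_44_all_of_at0 (fun m => unmarkedEdgeHypAt_row_of_keyHypAt 44 0 (h m)) w a b c y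

/-- **PATH (row 36) on every finite weighted graph from TWO families of KEY forms** (at the hub `a` and at the leaf `c`):
`0 ≤ E₃(D[a|b], D[a|c], D[b|y])` for all `n`, `w`, `a b c y` — in particular 3PT-LB at `c = y`. [this work] -/
theorem frontier_36_all_of_key0_key2
    (h0 : ∀ m : ℕ, KeyHypAt 0 (fun x : Fin 4 → Fin m => connEvent (FrontierDecRows.row 36 m (x 0, x 1, x 2, x 3)).1)
      (fun x => connEvent (FrontierDecRows.row 36 m (x 0, x 1, x 2, x 3)).2.1)
      (fun x => connEvent (FrontierDecRows.row 36 m (x 0, x 1, x 2, x 3)).2.2))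
    (h2 : ∀ m : ℕ, KeyHypAt 2 (fun x : Fin 4 → Fin m => connEvent (FrontierDecRows.row 36 m (x 0, x 1, x 2, x 3)).1)
      (fun x => connEvent (FrontierDecRows.row 36 m (x 0, x 1, x 2, x 3)).2.1)
      (fun x => connEvent (FrontierDecRows.row 36 m (x 0, x 1, x 2, x 3)).2.2))
    (w : Sym2 (Fin n) → unitInterval) (a b c y : Fin n) :
    0 ≤ sahiE3 (prodBernoulli w) (connEvent (FrontierDecRows.row 36 n (a, b, c, y)).1)
      (connEvent (FrontierDecRows.row 36 n (a, b, c, y)).2.1) (connEvent (FrontierDecRows.row 36 n (a, b, c, y)).2.2) :=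
  frontier_36_all_of_at0_at2 (fun m => unmarkedEdgeHypAt_row_of_keyHypAt 36 0 (h0 m))
    (fun m => unmarkedEdgeHypAt_row_of_keyHypAt 36 2 (h2 m)) w a b c y

/-- **Every essential decreasing frontier row for ALL `n` from its KEY forms at all terminals** (pairwise distinct marking; the degenerate
markings of rows 36/44 are covered by the two theorems above). [this work] -/
theorem frontier_all_of_keyHyp (i : Fin 45)
    (h : ∀ (m : ℕ) (i₀ : Fin 4), KeyHypAt i₀ (fun x : Fin 4 → Fin m => connEvent (FrontierDecRows.row i m (x 0, x 1, x 2, x 3)).1)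
      (fun x => connEvent (FrontierDecRows.row i m (x 0, x 1, x 2, x 3)).2.1)
      (fun x => connEvent (FrontierDecRows.row i m (x 0, x 1, x 2, x 3)).2.2))
    (w : Sym2 (Fin n) → unitInterval) (a b c y : Fin n) (hab : a ≠ b) (hac : a ≠ c) (hay : a ≠ y) (hbc : b ≠ c)
    (hby : b ≠ y) (hcy : c ≠ y) :
    0 ≤ sahiE3 (prodBernoulli w) (connEvent (FrontierDecRows.row i n (a, b, c, y)).1)
      (connEvent (FrontierDecRows.row i n (a, b, c, y)).2.1) (connEvent (FrontierDecRows.row i n (a, b, c, y)).2.2) :=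
  frontier_all_of_unmarkedEdgeHyp i
    (fun m => unmarkedEdgeHyp_of_forall_at fun i₀ => unmarkedEdgeHypAt_row_of_keyHypAt i i₀ (h m i₀)) w a b c y hab hac hay
    hbc hby hcy

end TerminalEdgeInduction

end Summit.CriticalPhenomena.PercolationContinuityZ3.Theorems
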